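import Summits.ResolutionOfSingularities.ResolutionOfSingularities.Theorems.FrobeniusClosingPatchingRelPerfectDepthSNCPointwiseTransport
import Summits.ResolutionOfSingularities.ResolutionOfSingularities.Theorems.FrobeniusClosingPatchingRelPerfectDepthHostMonoFormat
import HarnessLib

/-!
# Crux `PatchingRelPerfect` (stmt-ResolutionOfSingularities-16161), chain W5.2 — rung R4ˢ-general, END-SNC off `E′`:
# the POCKET INVARIANT «snc at every cosupport point off the exceptional hypersurface» and its propagation

[OURS · L1 W5.2 · rung tool] Replaces the role of NO printed item; NOT a statement of the manuscript under review;
fact-free, any dimension. res-L1-w52-plan-1 F5 DESIGN MEMO (T5-H `EndSNCTwo`), split res-D-pv-052 (points of `E′`)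
/ res-D-pv-009 (points off `E′`, 07:17:55Z). Along the X-side tower of the mixed engine every blowing up `σ` has
its centre `Ĉ` inside the current exceptional hypersurface `i(E)`; the strict transform `i′(E′)` and the new
exceptional divisor `V(Ĉ𝒪)` cover `σ⁻¹(i(E))`. Hence a cosupport point of the new residual `K′` OFF `i′(E′)` lies
either over the centre (a point of the new carrier — a POCKET) or over a cosupport point of `K` off `i(E)` (a FROZEN
point, where `σ` is a local isomorphism). With the pointwise transport of `…DepthSNCPointwiseTransport.lean` this gives
the propagation of the invariant

  `PocketSNC`: `∀ x ∈ cosupp K, x ∉ i(E) → SNCWithAt Es ⊤ x`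

through every step, the only input being simple normal crossings WITH THE CENTRE at the centre points under the new
off-`E′` cosupport (the E-side JOINT clause, lifted to `X` by res-D-pv-052's retraction lemma) — `pocketSNC_step`.
Supporting lemmas: `mem_range_or_mem_support_of_ker_fac` / `…_of_strictTransform` (`σ⁻¹(i(E)) ⊆ i′(E′) ∪ V(Ĉ𝒪)` from
`𝓘_E𝒪 = Ĉ𝒪·𝓘_{E′}`), and the CARRIER-FREE FULL-WEIGHT vanishing `not_mem_support_controlledTransform_of_full_weight`
(at a full-weight step, over a centre point missed by the contact monomial `N`, the residual has no cosupport off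
`E′`: `σᶜ(K, ℓ) ⊇ σ^*N·𝓘_{E′}^ℓ`), which discharges the centre hypothesis there.

## References
* J. Kollár, *Lectures on Resolution of Singularities* (2007), Def. 3.25, (3.111) Step 3. [Kollar2007]
* E. Bierstone, D. Grigoriev, P. Milman, J. Włodarczyk, arXiv:1206.3090, §3.2 Lemma 3.2.1, §4 Remark (3).
  [BierstoneGrigorievMilmanWlodarczyk2011]
* U. Görtz, T. Wedhorn, *Algebraic Geometry I*, 2nd ed. (2020), Prop. 13.91 (1), Prop. 13.96 (2). [GortzWedhorn2020]
-/

-- `Summit.<Summit>.<Sub>.Theorems` with `Sub = Summit` (single-conjunct summit, D-0017)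
set_option linter.dupNamespace false

noncomputable section

open CategoryTheory CategoryTheory.Limits AlgebraicGeometry TopologicalSpace IsLocalRing
open Literature.AlgebraicGeometry.Resolution
open Scheme.IdealSheafData

namespace Summit.ResolutionOfSingularities.ResolutionOfSingularities.Theorems

universe u

namespace DepthSNC

variable {E X E' X' : Scheme.{u}}

/-! ## §1 `σ⁻¹(i(E)) ⊆ i′(E′) ∪ V(Ĉ𝒪)` -/

/-- The image of a closed immersion is the support of its kernel. [folklore] -/
theorem range_eq_support_ker (i : E ⟶ X) [IsClosedImmersion i] :
    Set.range i.base = (i.ker.support : Set X) := by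
  rw [Scheme.Hom.support_ker, i.isClosedEmbedding.isClosed_range.closure_eq]

/-- **`σ⁻¹(i(E)) ⊆ i′(E′) ∪ V(Ĉ𝒪)`** from the factorisation `𝓘_E𝒪_{X′} = Ĉ𝒪_{X′} · 𝓘_{E′}` (total transform of
the hypersurface = exceptional divisor + strict transform). [cite: GortzWedhorn2020, Prop. 13.96 (2)] -/
theorem mem_range_or_mem_support_of_ker_fac {i : E ⟶ X} [IsClosedImmersion i] {σ : X' ⟶ X} {i' : E' ⟶ X'}
    [IsClosedImmersion i'] {Ch : X.IdealSheafData} (hfac : Ch.comap σ * i'.ker = i.ker.comap σ) (x' : X')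
    (hx : σ.base x' ∈ Set.range i.base) : x' ∈ Set.range i'.base ∨ σ.base x' ∈ (Ch.support : Set X) := by
  rw [range_eq_support_ker i] at hx
  have h1 : x' ∈ ((i.ker.comap σ).support : Set X') := by
    rw [Scheme.IdealSheafData.support_comap]; exact hx
  rw [← hfac, Scheme.IdealSheafData.support_mul, TopologicalSpace.Closeds.coe_sup] at h1
  rcases h1 with h | h
  · right
    rwa [Scheme.IdealSheafData.support_comap] at h
  · left
    rwa [range_eq_support_ker i']

/-- **The same for the dictionary step of the X-side tower**: `X` regular locally Noetherian, `E` regular,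
`i : E ⟶ X` a closed immersion, `C` a centre on `E` with `V(C)` regular, `σ` a blow-up along `C.map i`, `τ` a
blow-up of `E` along `C`, `i′ : E′ ⟶ X′` with `i′ ≫ σ = τ ≫ i` (then `i′` IS the strict transform and
`𝓘_E𝒪 = Ĉ𝒪·𝓘_{E′}`). [cite: GortzWedhorn2020, Prop. 13.91 (1), Prop. 13.96 (2)] [cite: BierstoneGrigorievMilmanWlodarczyk2011, §4 Remark (3)] -/
theorem mem_range_or_mem_support_of_strictTransform [IsLocallyNoetherian X] {i : E ⟶ X} [IsClosedImmersion i]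
    (hX : Scheme.IsRegular X) (hE : Scheme.IsRegular E) {C : E.IdealSheafData}
    (hC : Scheme.IsRegular C.subscheme) {σ : X' ⟶ X} {τ : E' ⟶ E} (hσ : IsBlowup σ (C.map i))
    (hτ : IsBlowup τ C) {i' : E' ⟶ X'} (hsq : i' ≫ σ = τ ≫ i) (x' : X')
    (hx : σ.base x' ∈ Set.range i.base) :
    x' ∈ Set.range i'.base ∨ σ.base x' ∈ ((C.map i).support : Set X) := by
  set Ch : X.IdealSheafData := C.map i with hCh
  have hkerCh : i.ker ≤ Ch := DepthOne.ker_le_map_centre i C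
  have hChreg : Scheme.IsRegular Ch.subscheme := DepthOne.isRegular_subscheme_map i C hC
  have hτ' : IsBlowup τ (Ch.comap i) := by rw [hCh, DepthOne.comap_map_centre]; exact hτ
  have hi' : i' = hσ.strictTransformHom hτ' := by
    apply hσ.hom_ext
    · rw [hsq, Scheme.IdealSheafData.comap_comp, hCh, DepthOne.comap_map_centre]
      exact hτ.isEffectiveCartier
    · rw [hsq, hσ.strictTransformHom_comp hτ']
  haveI : IsClosedImmersion (hσ.strictTransformHom hτ') :=
    hσ.isClosedImmersion_of_comp_eq hτ' (hσ.strictTransformHom_comp hτ')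
  have hker : (hσ.strictTransformHom hτ').ker = controlledTransform σ Ch i.ker 1 :=
    hσ.ker_strictTransformHom_of_isRegular hX hChreg hτ' hkerCh (DepthOne.isRegular_subscheme_ker i hE)
  have hfac : Ch.comap σ * (hσ.strictTransformHom hτ').ker = i.ker.comap σ := by
    rw [hker]; exact hσ.comap_mul_controlledTransform_one hkerCh
  subst hi'
  exact mem_range_or_mem_support_of_ker_fac hfac x' hx

/-! ## §2 The pocket invariant and its propagation -/

/-- [OURS · L1 W5.2] **PROPAGATION OF THE POCKET INVARIANT.** Let `σ : X′ ⟶ X` be a blow-up along `Ĉ` (`X` locally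
Noetherian), `i : E ⟶ X` and `i′ : E′ ⟶ X′` with `σ⁻¹(i(E)) ⊆ i′(E′) ∪ V(Ĉ)` (`hrange`, §1), `K, K′` ideals with
`cosupp K′ ⊆ σ⁻¹(cosupp K)` (`hK′`; any controlled transform), `Es` a family on `X` and `Es′` a family on `X′`
whose members through each point belong to the transformed family `Es.map (strictTransformIdeal σ Ĉ) ++ [Ĉ𝒪]`
(`hEs′`; a sub-family — e.g. the new exceptional divisor is listed only when it is charged). Suppose (FROZEN INPUT) `Es` has simple normal crossings at every cosupport point of `K` off `i(E)`,
and (POCKET INPUT) `Es` has simple normal crossings WITH `Ĉ` at `σ x′` for every cosupport point `x′` of `K′` off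
`i′(E′)` lying over `V(Ĉ)`. Then `Es′` has simple normal crossings at every cosupport point of `K′` off `i′(E′)`.
[cite: Kollar2007, Def. 3.25] -/
theorem pocketSNC_step [IsLocallyNoetherian X] {σ : X' ⟶ X} {Ch : X.IdealSheafData} (hσ : IsBlowup σ Ch)
    {i : E ⟶ X} {i' : E' ⟶ X'}
    (hrange : ∀ x' : X', σ.base x' ∈ Set.range i.base →
      x' ∈ Set.range i'.base ∨ σ.base x' ∈ (Ch.support : Set X))
    {K : X.IdealSheafData} {K' : X'.IdealSheafData}
    (hK' : ∀ x' : X', x' ∈ (K'.support : Set X') → σ.base x' ∈ (K.support : Set X))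
    {Es : List X.IdealSheafData} {Es' : List X'.IdealSheafData}
    (hEs' : ∀ D ∈ Es', ∀ x' : X', x' ∈ D.support → D ∈ Es.map (strictTransformIdeal σ Ch) ++ [Ch.comap σ])
    (hfrozen : ∀ x : X, x ∈ (K.support : Set X) → x ∉ Set.range i.base → SNCWithAt Es ⊤ x)
    (hpocket : ∀ x' : X', x' ∈ (K'.support : Set X') → x' ∉ Set.range i'.base →
      σ.base x' ∈ (Ch.support : Set X) → SNCWithAt Es Ch (σ.base x')) :
    ∀ x' : X', x' ∈ (K'.support : Set X') → x' ∉ Set.range i'.base → SNCWithAt Es' ⊤ x' := by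
  haveI : IsProper σ := hσ.isProper
  haveI : IsLocallyNoetherian X' := LocallyOfFiniteType.isLocallyNoetherian σ
  intro x' hx'K hx'E
  have hEs'x : ∀ D ∈ Es', x' ∈ D.support → D ∈ Es.map (strictTransformIdeal σ Ch) ++ [Ch.comap σ] :=
    fun D hD hx => hEs' D hD x' hx
  by_cases hxC : σ.base x' ∈ (Ch.support : Set X)
  · -- a POCKET point: over the centre, snc with the centre at `σ x'` transforms
    exact (hσ.sncWithAt_transform_of_mem_support x' (hpocket x' hx'K hx'E hxC) hxC).anti hEs'x
  · -- a FROZEN point: `σ x'` is a cosupport point of `K` off `i(E)`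
    have hxE : σ.base x' ∉ Set.range i.base := by
      intro h
      rcases hrange x' h with h1 | h1
      · exact hx'E h1
      · exact hxC h1
    have h := hfrozen _ (hK' x' hx'K) hxE
    exact ((hσ.sncWithAt_transform_of_not_mem_support x' (h.of_not_mem_support hxC) hxC).top).anti hEs'x

/-- The cosupport of a controlled transform lies over the cosupport (`σᶜ(K, ν) ⊇ σ^*K`) — the hypothesis `hK′`
of `pocketSNC_step` for the steps of the tower. [folklore] -/
theorem mem_support_of_mem_support_controlledTransform {σ : X' ⟶ X} (Ch K : X.IdealSheafData) (ν : ℕ)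
    (x' : X') (hx' : x' ∈ ((controlledTransform σ Ch K ν).support : Set X')) :
    σ.base x' ∈ (K.support : Set X) := by
  have h := Scheme.IdealSheafData.support_antitone (comap_le_controlledTransform σ Ch K ν) hx'
  rwa [Scheme.IdealSheafData.support_comap] at h

/-- **The pocket invariant at an INITIAL state is vacuous**: with the unit contact monomial (`𝓘_E^ℓ ≤ K`, e.g.
`K = 𝓗 ⊔ 𝓘_E^ℓ`) the cosupport of `K` lies inside `i(E)`. [folklore] -/
theorem pocketSNC_initial {i : E ⟶ X} [IsClosedImmersion i] {ℓ : ℕ} {K : X.IdealSheafData} (hK : i.ker ^ ℓ ≤ K)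
    (Es : List X.IdealSheafData) :
    ∀ x : X, x ∈ (K.support : Set X) → x ∉ Set.range i.base → SNCWithAt Es ⊤ x := by
  intro x hxK hxE
  exfalso
  have h1 : x ∈ ((i.ker ^ ℓ).support : Set X) := Scheme.IdealSheafData.support_antitone hK hxK
  rcases Nat.eq_zero_or_pos ℓ with h0 | hpos
  · rw [h0, pow_zero, Scheme.IdealSheafData.one_eq_top, Scheme.IdealSheafData.support_top] at h1
    exact h1
  · rw [Scheme.IdealSheafData.support_pow _ _ hpos.ne', ← range_eq_support_ker] at h1
    exact hxE h1

/-! ## §3 Carrier-free full-weight steps create no cosupport off `E′` -/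

/-- **At a FULL-WEIGHT step, over a centre point missed by the contact monomial, the new residual has no
cosupport off `E′`.** `X` regular locally Noetherian, `E` regular, `i : E ⟶ X` a closed immersion, monomial
contact `N · 𝓘_E^ℓ ≤ K`, `C ⊆ E` a regular centre, `σ`/`τ`/`i′` the blow-up data with `i′ ≫ σ = τ ≫ i`. Then
`σᶜ(K, ℓ) ⊇ σᶜ(N·𝓘_E^ℓ, ℓ) = σ^*N · 𝓘_{E′}^ℓ` (`HostMonoFormat.controlledTransform_ker_pow`), whose stalk at a
point `x′ ∉ i′(E′)` with `σ x′ ∉ V(N)` is the unit ideal. (Under the max-weight policy a full-weight centre meets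
no carrier, so this discharges the POCKET INPUT of `pocketSNC_step` at such steps.)
[cite: BierstoneGrigorievMilmanWlodarczyk2011, §3.2 Lemma 3.2.1, §4 Remark (3)] [cite: GortzWedhorn2020, Prop. 13.96 (2)] -/
theorem not_mem_support_controlledTransform_of_full_weight [IsLocallyNoetherian X] {i : E ⟶ X}
    [IsClosedImmersion i] (hX : Scheme.IsRegular X) (hE : Scheme.IsRegular E) {ℓ : ℕ}
    {K N : X.IdealSheafData} (hNK : N * i.ker ^ ℓ ≤ K) {C : E.IdealSheafData}
    (hC : Scheme.IsRegular C.subscheme) {σ : X' ⟶ X} {τ : E' ⟶ E} (hσ : IsBlowup σ (C.map i))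
    (hτ : IsBlowup τ C) {i' : E' ⟶ X'} (hsq : i' ≫ σ = τ ≫ i) {x' : X'} (hx'E : x' ∉ Set.range i'.base)
    (hx'N : σ.base x' ∉ (N.support : Set X)) :
    x' ∉ ((controlledTransform σ (C.map i) K ℓ).support : Set X') := by
  set Ch : X.IdealSheafData := C.map i with hCh
  have hτ' : IsBlowup τ (Ch.comap i) := by rw [hCh, DepthOne.comap_map_centre]; exact hτ
  have hi' : i' = hσ.strictTransformHom hτ' := by
    apply hσ.hom_ext
    · rw [hsq, Scheme.IdealSheafData.comap_comp, hCh, DepthOne.comap_map_centre]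
      exact hτ.isEffectiveCartier
    · rw [hsq, hσ.strictTransformHom_comp hτ']
  haveI : IsClosedImmersion (hσ.strictTransformHom hτ') :=
    hσ.isClosedImmersion_of_comp_eq hτ' (hσ.strictTransformHom_comp hτ')
  haveI : IsProper σ := hσ.isProper
  haveI : IsLocallyNoetherian X' := LocallyOfFiniteType.isLocallyNoetherian σ
  -- `σᶜ(N·𝓘_E^ℓ, ℓ) = σ^*N · 𝓘_{E'}^ℓ`
  have hexc : IsEffectiveCartier (Ch.comap σ) := hσ.isEffectiveCartier
  have hNσ : N.comap σ ≤ Ch.comap σ ^ 0 := by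
    rw [pow_zero, Scheme.IdealSheafData.one_eq_top]; exact le_top
  have hkerσ : (i.ker ^ ℓ).comap σ ≤ Ch.comap σ ^ ℓ := by
    have h1 : i.ker ^ ℓ ≤ Ch ^ ℓ := pow_le_pow_left' (DepthOne.ker_le_map_centre i C) ℓ
    have h2 : (i.ker ^ ℓ).comap σ ≤ (Ch ^ ℓ).comap σ := Scheme.IdealSheafData.comap_mono (f := σ) h1
    rw [comap_pow σ Ch ℓ] at h2
    exact h2
  have hkp := DepthGraded.HostMonoFormat.controlledTransform_ker_pow (ℓ := ℓ) (i := i) hX hE hC le_rfl hσ hτ'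
  have hmul := controlledTransform_mul hexc hNσ hkerσ
  rw [zero_add, controlledTransform_zero, hkp, Nat.sub_self, pow_zero, Scheme.IdealSheafData.one_eq_top,
    top_mul] at hmul
  -- monotonicity: `σᶜ(N·𝓘_E^ℓ, ℓ) ≤ σᶜ(K, ℓ)`
  have hle : controlledTransform σ Ch (N * i.ker ^ ℓ) ℓ ≤ controlledTransform σ Ch K ℓ :=
    colon_mono_left (Scheme.IdealSheafData.comap_mono (f := σ) hNK) _
  rw [hmul] at hle
  -- the stalk of `σ^*N · 𝓘_{E'}^ℓ` at `x'` is the unit ideal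
  intro hx'
  have h1 : x' ∈ ((N.comap σ * (hσ.strictTransformHom hτ').ker ^ ℓ).support : Set X') :=
    Scheme.IdealSheafData.support_antitone hle hx'
  rw [Scheme.IdealSheafData.support_mul, TopologicalSpace.Closeds.coe_sup] at h1
  rcases h1 with h | h
  · rw [Scheme.IdealSheafData.support_comap] at h
    exact hx'N h
  · rcases Nat.eq_zero_or_pos ℓ with h0 | hpos
    · rw [h0, pow_zero, Scheme.IdealSheafData.one_eq_top, Scheme.IdealSheafData.support_top] at h
      exact h
    · rw [Scheme.IdealSheafData.support_pow _ _ hpos.ne', ← range_eq_support_ker, ← hi'] at h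
      exact hx'E h

end DepthSNC

end Summit.ResolutionOfSingularities.ResolutionOfSingularities.Theorems

end
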